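import Summits.QuantumFields.BalabanUV.T4Continuum.Support.NE7CornerBumpFlatLHCI
import HarnessLib

/-!
# NE7CornerBumpGram — THE GRAM CONSTANT OF THE CORNER BUMP IS OF THE MAXIMAL ORDER: `Σ_{r∈[0,M)^d} (Lρ(r))² ≥ (M∕16)^d · (d·(M²∕8)·(M⁴∕1024)^{d−1})²`
# (`≍ M^{9d−4}`, every `M ≥ 8`) — the denominator of the flat Galerkin sup letter of the bump class; file 30

Cell `pub-balaban`, rung (B)+1 sub-cell t4, lineage `b2b-balaban-t4-ne7-p1` (CRUX PROVER NE7 #1 = OWNER of row NE7), generation 78; memo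
`t4/b2b-balaban-t4-ne7-p1-g78/BUMP-CLASS-FLAT.md` §4.  File F99 (over F96 `NE7CornerBumpFlatLHCI`'s profile `ψ`∕`ρ`).
WHY (memo §4).  The Galerkin residual of the bump class at `W = 1` is `g = K + Φ_{Lρ}C₁` with `‖Lρ‖₂²·C₁(w) = Σ_r Lρ(r)•F(M•w + r − s)` (F97's projection
paired with `Φ_ρ` at one corner), so its sup letter `‖g‖ ≤ c_R‖F‖` is `M`-uniform exactly when `M^d·(sup|Lρ|)²∕‖Lρ‖₂²` is: `sup|Lρ| ≤ 3dM²(M⁴∕16)^{d−1}` (F96) and THIS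
FILE's lower bound `‖Lρ‖₂² ≥ (M∕16)^d(d(M²∕8)(M⁴∕1024)^{d−1})²` give the `M`-free ratio `≤ 576·16^d·4096^{d−1}`.  MECHANISM: on the sub-box `r_i = ⌊M∕2⌋ + t_i`,
`0 ≤ t_i ≤ ⌊M∕16⌋` (inside `[3, M−3]^d`, `(⌊M∕16⌋+1)^d ≥ (M∕16)^d` points) every factor has `ψ(r_i) ≥ M⁴∕1024` and second difference `≤ −M²∕8`
(`p(u+1) − 2p(u) + p(u−1) = 2K² + 2 − 12u(K−u)` with `u(K−u) = K²∕4 − δ²`, `δ² ≤ M²∕256 + 1∕4`, `K = M − 4 ≥ M∕2`), so `Lρ(r) = Σ_ν (−ψ″(r_ν))Π_{j≠ν}ψ(r_j) ≥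
d(M²∕8)(M⁴∕1024)^{d−1} > 0` there.
WHAT ([folklore]; 0 def, 0 sorry; profile by equational hypotheses as in F96).  §1 `psi_center_bounds` (the two one-dimensional bounds on the central range);
§2 `lapRho_center_lower` (the pointwise lower bound on the sub-box); §3 **`gram_lapRho_lower`**.
HONEST FRAMING (page 1): one-variable polynomial calculus and counting; nothing of Bałaban's asserted; (APE) NOT proved; NOT ONE-STEP, NOT NE7; spine 0∕9; finite T⁴
rung (B)+1 — NOT infinite volume, NOT mass gap, NOT `BetaPertH`, NOT Clay.  Continuum YM on T⁴ ⇐ BetaPertH ∧ nine spine estimates (0/9 proved); BetaPertH ⇐ (D1) ∧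
(D4) ∧ CAP+tail; G-an2-4 gates asym, D1 and NE2/3/4.
-/

set_option autoImplicit false

open scoped BigOperators
open Finset

namespace Summit.QuantumFields.BalabanUV.T4Continuum.NE7CornerBumpGram

open Literature.MathematicalPhysics.QuantumFieldTheory.Balaban1983to89
open B7Prop1Explicit
open T4AveragingDeficitWallBoundary (periodBox mem_periodBox)
open NE7CornerBumpFlatLHCI (psi_nonneg psi_le)

noncomputable section

variable {d : ℕ}

/-! ## §1 The profile on the central range `⌊M∕2⌋ ≤ r ≤ ⌊M∕2⌋ + ⌊M∕16⌋` -/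

/-- **THE TWO ONE-DIMENSIONAL BOUNDS ON THE CENTRAL RANGE** (`M ≥ 8`, `0 ≤ t ≤ ⌊M∕16⌋`, `r = ⌊M∕2⌋ + t`): `ψ(r) ≥ M⁴∕1024` and
`ψ(r+1) − 2ψ(r) + ψ(r−1) ≤ −M²∕8`. [folklore] -/
theorem psi_center_bounds {M : ℕ} (hM : 8 ≤ M) {ψ : ℤ → ℝ}
    (hψ : ∀ t : ℤ, ψ t = if 2 ≤ t ∧ t ≤ (M : ℤ) - 2 then (((t : ℝ) - 2) * ((M : ℝ) - 2 - t)) ^ 2 else 0)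
    {t : ℕ} (ht : t ≤ M / 16) :
    (M : ℝ) ^ 4 / 1024 ≤ ψ ((M / 2 + t : ℕ) : ℤ) ∧
      ψ (((M / 2 + t : ℕ) : ℤ) + 1) - 2 * ψ ((M / 2 + t : ℕ) : ℤ) + ψ (((M / 2 + t : ℕ) : ℤ) - 1) ≤ -((M : ℝ) ^ 2 / 8) := by
  have hc1 : 2 * (M / 2) ≤ M := Nat.mul_div_le M 2
  have hc2 : M < 2 * (M / 2) + 2 := by omega
  have hq1 : 16 * (M / 16) ≤ M := Nat.mul_div_le M 16
  -- the three points are inside `[2, M−2]`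
  have hin0 : (2 : ℤ) ≤ ((M / 2 + t : ℕ) : ℤ) ∧ ((M / 2 + t : ℕ) : ℤ) ≤ (M : ℤ) - 2 := by omega
  have hinp : (2 : ℤ) ≤ ((M / 2 + t : ℕ) : ℤ) + 1 ∧ ((M / 2 + t : ℕ) : ℤ) + 1 ≤ (M : ℤ) - 2 := by omega
  have hinm : (2 : ℤ) ≤ ((M / 2 + t : ℕ) : ℤ) - 1 ∧ ((M / 2 + t : ℕ) : ℤ) - 1 ≤ (M : ℤ) - 2 := by omega
  rw [hψ (((M / 2 + t : ℕ) : ℤ) + 1), hψ ((M / 2 + t : ℕ) : ℤ), hψ (((M / 2 + t : ℕ) : ℤ) - 1), if_pos hin0, if_pos hinp, if_pos hinm]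
  simp only [Int.cast_add, Int.cast_sub, Int.cast_one, Int.cast_natCast, Nat.cast_add]
  -- real bookkeeping: `δ = r − M∕2 ∈ [−1∕2, M∕16]`
  set r : ℝ := ((M / 2 : ℕ) : ℝ) + (t : ℝ) with hr
  have hM' : (8 : ℝ) ≤ M := by exact_mod_cast hM
  have hcR1 : 2 * ((M / 2 : ℕ) : ℝ) ≤ M := by exact_mod_cast hc1
  have hcR2 : (M : ℝ) ≤ 2 * ((M / 2 : ℕ) : ℝ) + 1 := by exact_mod_cast (by omega : M ≤ 2 * (M / 2) + 1)
  have htR0 : (0 : ℝ) ≤ t := by positivity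
  have htR1 : 16 * (t : ℝ) ≤ M := by
    have : 16 * t ≤ M := by omega
    exact_mod_cast this
  set δ : ℝ := r - (M : ℝ) / 2 with hδ
  have hδlo : -1 / 2 ≤ δ := by rw [hδ, hr]; linarith
  have hδhi : δ ≤ (M : ℝ) / 16 := by rw [hδ, hr]; linarith
  have hδsq : δ ^ 2 ≤ ((M : ℝ) / 16) ^ 2 + 1 / 4 := by
    rcases le_or_gt 0 δ with h0 | h0
    · have e := pow_le_pow_left₀ h0 hδhi 2
      linarith
    · have e := pow_le_pow_left₀ (neg_nonneg.2 h0.le) (by linarith : -δ ≤ 1 / 2) 2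
      rw [neg_sq] at e
      have : ((1 : ℝ) / 2) ^ 2 = 1 / 4 := by norm_num
      rw [this] at e
      linarith [sq_nonneg ((M : ℝ) / 16)]
  -- `u = r − 2`, `v = M − 2 − r`, `uv = K²∕4 − δ²`, `K = M − 4`
  have huv : (r - 2) * ((M : ℝ) - 2 - r) = ((M : ℝ) - 4) ^ 2 / 4 - δ ^ 2 := by rw [hδ]; ring
  have hpoly : 3 * (M : ℝ) ^ 2 / 64 + 5 ≤ ((M : ℝ) - 4) ^ 2 / 2 := by
    have h := mul_nonneg (sub_nonneg.2 hM') (show (0 : ℝ) ≤ 29 * M - 24 by linarith)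
    have e : ((M : ℝ) - 4) ^ 2 / 2 - (3 * (M : ℝ) ^ 2 / 64 + 5) = ((M : ℝ) - 8) * (29 * M - 24) / 64 := by ring
    linarith [e, h]
  have h16 : 12 * (((M : ℝ) / 16) ^ 2 + 1 / 4) = 3 * (M : ℝ) ^ 2 / 64 + 3 := by ring
  have hkey : 12 * δ ^ 2 + 2 ≤ ((M : ℝ) - 4) ^ 2 / 2 := by linarith [hδsq, hpoly, h16]
  have hK : (M : ℝ) / 2 ≤ (M : ℝ) - 4 := by linarith
  have hKsq : (M : ℝ) ^ 2 / 4 ≤ ((M : ℝ) - 4) ^ 2 := by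
    have e := pow_le_pow_left₀ (by positivity : (0 : ℝ) ≤ (M : ℝ) / 2) hK 2
    have : ((M : ℝ) / 2) ^ 2 = (M : ℝ) ^ 2 / 4 := by ring
    rw [this] at e; exact e
  constructor
  · -- `ψ(r) = (uv)² ≥ (K²∕8)² ≥ M⁴∕1024`
    have h1 : ((M : ℝ) - 4) ^ 2 / 8 ≤ (r - 2) * ((M : ℝ) - 2 - r) := by
      rw [huv]; linarith [hkey, sq_nonneg ((M : ℝ) - 4), sq_nonneg δ]
    have h2 : (M : ℝ) ^ 2 / 32 ≤ ((M : ℝ) - 4) ^ 2 / 8 := by linarith [hKsq]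
    calc (M : ℝ) ^ 4 / 1024 = ((M : ℝ) ^ 2 / 32) ^ 2 := by ring
      _ ≤ ((r - 2) * ((M : ℝ) - 2 - r)) ^ 2 := pow_le_pow_left₀ (by positivity) (h2.trans h1) 2
  · -- the second difference `= 2K² + 2 − 12uv ≤ −K²∕2 ≤ −M²∕8`
    have hid : ((r + 1 - 2) * ((M : ℝ) - 2 - (r + 1))) ^ 2 - 2 * ((r - 2) * ((M : ℝ) - 2 - r)) ^ 2
        + ((r - 1 - 2) * ((M : ℝ) - 2 - (r - 1))) ^ 2
        = 2 * ((M : ℝ) - 4) ^ 2 + 2 - 12 * ((r - 2) * ((M : ℝ) - 2 - r)) := by ring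
    rw [hid, huv]
    have h3 : (M : ℝ) ^ 2 / 8 ≤ ((M : ℝ) - 4) ^ 2 / 2 := by linarith [hKsq]
    linarith [hkey, h3]

/-! ## §2 The pointwise lower bound of `Lρ` on the central sub-box -/

/-- **ON THE CENTRAL SUB-BOX `Lρ(r) ≥ d·(M²∕8)·(M⁴∕1024)^{d−1}`** (`r_i = ⌊M∕2⌋ + t_i`, `t_i ≤ ⌊M∕16⌋`). [folklore] -/
theorem lapRho_center_lower {M : ℕ} (hM : 8 ≤ M) {ψ : ℤ → ℝ}
    (hψ : ∀ t : ℤ, ψ t = if 2 ≤ t ∧ t ≤ (M : ℤ) - 2 then (((t : ℝ) - 2) * ((M : ℝ) - 2 - t)) ^ 2 else 0)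
    {ρ : Site d → ℝ} (hρ : ∀ r, ρ r = ∏ i, ψ (r i)) (t : Fin d → ℕ) (ht : ∀ i, t i ≤ M / 16) :
    (d : ℝ) * ((M : ℝ) ^ 2 / 8 * ((M : ℝ) ^ 4 / 1024) ^ (d - 1))
      ≤ (fun r' : Site d => ∑ ν : Fin d, (2 * ρ r' - ρ (r' - e ν) - ρ (r' + e ν))) (fun i => ((M / 2 + t i : ℕ) : ℤ)) := by
  set r : Site d := fun i => ((M / 2 + t i : ℕ) : ℤ) with hr
  simp only
  have hterm : ∀ ν : Fin d, (M : ℝ) ^ 2 / 8 * ((M : ℝ) ^ 4 / 1024) ^ (d - 1) ≤ 2 * ρ r - ρ (r - e ν) - ρ (r + e ν) := by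
    intro ν
    have hp : ρ r = ψ (r ν) * ∏ i ∈ Finset.univ.erase ν, ψ (r i) := by
      rw [hρ, ← Finset.mul_prod_erase _ _ (Finset.mem_univ ν)]
    have hplus : ρ (r + e ν) = ψ (r ν + 1) * ∏ i ∈ Finset.univ.erase ν, ψ (r i) := by
      rw [hρ, ← Finset.mul_prod_erase _ _ (Finset.mem_univ ν)]
      congr 1
      · simp [e_apply]
      · exact Finset.prod_congr rfl fun i hi => by simp [e_apply, Finset.ne_of_mem_erase hi]
    have hminus : ρ (r - e ν) = ψ (r ν - 1) * ∏ i ∈ Finset.univ.erase ν, ψ (r i) := by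
      rw [hρ, ← Finset.mul_prod_erase _ _ (Finset.mem_univ ν)]
      congr 1
      · simp [e_apply]
      · exact Finset.prod_congr rfl fun i hi => by simp [e_apply, Finset.ne_of_mem_erase hi]
    have hfac : 2 * ρ r - ρ (r - e ν) - ρ (r + e ν)
        = -(ψ (r ν + 1) - 2 * ψ (r ν) + ψ (r ν - 1)) * ∏ i ∈ Finset.univ.erase ν, ψ (r i) := by rw [hp, hplus, hminus]; ring
    rw [hfac]
    have hsd : (M : ℝ) ^ 2 / 8 ≤ -(ψ (r ν + 1) - 2 * ψ (r ν) + ψ (r ν - 1)) := by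
      have := (psi_center_bounds hM hψ (ht ν)).2
      simp only [hr]; linarith
    have hprod : ((M : ℝ) ^ 4 / 1024) ^ (d - 1) ≤ ∏ i ∈ Finset.univ.erase ν, ψ (r i) := by
      calc ((M : ℝ) ^ 4 / 1024) ^ (d - 1) = ∏ _i ∈ Finset.univ.erase ν, (M : ℝ) ^ 4 / 1024 := by
            rw [Finset.prod_const, Finset.card_erase_of_mem (Finset.mem_univ ν), Finset.card_univ, Fintype.card_fin]
        _ ≤ ∏ i ∈ Finset.univ.erase ν, ψ (r i) :=
            Finset.prod_le_prod (fun i _ => by positivity) (fun i _ => by simp only [hr]; exact (psi_center_bounds hM hψ (ht i)).1)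
    exact mul_le_mul hsd hprod (by positivity) ((by positivity : (0 : ℝ) ≤ (M : ℝ) ^ 2 / 8).trans hsd)
  calc (d : ℝ) * ((M : ℝ) ^ 2 / 8 * ((M : ℝ) ^ 4 / 1024) ^ (d - 1))
      = ∑ _ν : Fin d, (M : ℝ) ^ 2 / 8 * ((M : ℝ) ^ 4 / 1024) ^ (d - 1) := by
        rw [Finset.sum_const, Finset.card_univ, Fintype.card_fin, nsmul_eq_mul]
    _ ≤ ∑ ν : Fin d, (2 * ρ r - ρ (r - e ν) - ρ (r + e ν)) := Finset.sum_le_sum fun ν _ => hterm ν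

/-! ## §3 The Gram constant -/

/-- **THE GRAM CONSTANT OF THE BUMP**: `Σ_{r∈[0,M)^d} (Lρ(r))² ≥ (M∕16)^d·(d·(M²∕8)·(M⁴∕1024)^{d−1})²` (`M ≥ 8`). [folklore] -/
theorem gram_lapRho_lower {M : ℕ} (hM : 8 ≤ M) {ψ : ℤ → ℝ}
    (hψ : ∀ t : ℤ, ψ t = if 2 ≤ t ∧ t ≤ (M : ℤ) - 2 then (((t : ℝ) - 2) * ((M : ℝ) - 2 - t)) ^ 2 else 0)
    {ρ : Site d → ℝ} (hρ : ∀ r, ρ r = ∏ i, ψ (r i))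
    {Lρ : Site d → ℝ} (hLρ : Lρ = fun r => ∑ ν : Fin d, (2 * ρ r - ρ (r - e ν) - ρ (r + e ν))) :
    ((M : ℝ) / 16) ^ d * ((d : ℝ) * ((M : ℝ) ^ 2 / 8 * ((M : ℝ) ^ 4 / 1024) ^ (d - 1))) ^ 2
      ≤ ∑ r ∈ periodBox (d := d) M, Lρ r * Lρ r := by
  set q : ℕ := M / 16 with hq
  have hq1 : 16 * q ≤ M := Nat.mul_div_le M 16
  have hq2 : M < 16 * q + 16 := by omega
  have hc1 : 2 * (M / 2) ≤ M := Nat.mul_div_le M 2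
  -- the sub-box as an injective image of `Fin d → Fin (q+1)`
  set pt : (Fin d → Fin (q + 1)) → Site d := fun t i => ((M / 2 + (t i : ℕ) : ℕ) : ℤ) with hpt
  have hinj : Function.Injective pt := by
    intro t t' h
    funext i
    have := congr_fun h i
    simp only [hpt] at this
    exact Fin.ext (by omega)
  have hsub : Finset.univ.image pt ⊆ periodBox (d := d) M := by
    intro r hr
    obtain ⟨t, -, rfl⟩ := Finset.mem_image.mp hr
    refine mem_periodBox.mpr fun i => ⟨by simp only [hpt]; positivity, ?_⟩
    simp only [hpt]
    have := (t i).isLt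
    omega
  set β : ℝ := (d : ℝ) * ((M : ℝ) ^ 2 / 8 * ((M : ℝ) ^ 4 / 1024) ^ (d - 1)) with hβ
  have hβ0 : 0 ≤ β := by positivity
  have hpoint : ∀ t : Fin d → Fin (q + 1), β ^ 2 ≤ Lρ (pt t) * Lρ (pt t) := by
    intro t
    have h1 : β ≤ Lρ (pt t) := by
      rw [hLρ]; exact lapRho_center_lower hM hψ hρ (fun i => (t i : ℕ)) (fun i => Nat.le_of_lt_succ (t i).isLt)
    rw [sq]; exact mul_le_mul h1 h1 hβ0 (hβ0.trans h1)
  -- count and assemble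
  have hcard : ((M : ℝ) / 16) ^ d ≤ ((Finset.univ : Finset (Fin d → Fin (q + 1))).card : ℝ) := by
    rw [Finset.card_univ, Fintype.card_fun, Fintype.card_fin, Fintype.card_fin]
    push_cast
    have hq' : (M : ℝ) / 16 ≤ ((q : ℕ) : ℝ) + 1 := by
      have : (M : ℝ) < 16 * (q : ℝ) + 16 := by exact_mod_cast hq2
      linarith
    exact pow_le_pow_left₀ (by positivity) hq' d
  calc ((M : ℝ) / 16) ^ d * β ^ 2 ≤ ((Finset.univ : Finset (Fin d → Fin (q + 1))).card : ℝ) * β ^ 2 :=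
        mul_le_mul_of_nonneg_right hcard (by positivity)
    _ = ∑ _t : Fin d → Fin (q + 1), β ^ 2 := by rw [Finset.sum_const, nsmul_eq_mul]
    _ ≤ ∑ t : Fin d → Fin (q + 1), Lρ (pt t) * Lρ (pt t) := Finset.sum_le_sum fun t _ => hpoint t
    _ = ∑ r ∈ Finset.univ.image pt, Lρ r * Lρ r := by rw [Finset.sum_image fun t _ t' _ h => hinj h]
    _ ≤ ∑ r ∈ periodBox (d := d) M, Lρ r * Lρ r := Finset.sum_le_sum_of_subset_of_nonneg hsub fun r _ _ => mul_self_nonneg _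

end

end Summit.QuantumFields.BalabanUV.T4Continuum.NE7CornerBumpGram
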